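import Literature.Geometry.Lorentzian.AFEndTransport
import Literature.Geometry.Lorentzian.InitialDataDilation
import Literature.Geometry.Lorentzian.AsymptoticFlatnessProofs
import Literature.Geometry.Lorentzian.FinalState

/-!
# Dilation of asymptotically flat ends: the Dafermos–Rodnianski rates and the admissible class

For the rescaled end `AFEnd.rescaleEnd e l` (`AFEndTransport.lean`) and the rescaled data
`(l² h, l k)`, the strong asymptotic flatness rates transport with mass `l M`
(`isStronglyAsymptoticallyFlatDR_rescaleEnd`: chain rule for `x ↦ x/l` on iterated derivatives,
`isLittleO_norm_iteratedFDeriv_comp_shrink`). Consequently the physical dilation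
`InitialDataSet.dilate` (`InitialDataDilation.lean`) preserves Christodoulou's admissible class
(`dilate_mem_admissibleVacuumData`), and so does the pointwise homothety `InitialDataSet.homothety`
on an arbitrary `3`-manifold (`homothety_mem_admissibleVacuumData`, cell form
`admissibleVacuumData_homothety_closed` = «S1 AdmissibleDilationClosed» of the final-state cells).
Dafermos–Rodnianski 2013, App. B.2.3; Christodoulou 1999, p. A24. Everything is proved; no
definitions, no named facts.

## References

* M. Dafermos, I. Rodnianski, *Lectures on black holes and linear waves* (2013), App. B.2.3.
  [DafermosRodnianski2013]
* D. Christodoulou, *On the global initial value problem and the issue of singularities*,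
  Class. Quantum Grav. 16 (1999) A23–A35, p. A24. [Christodoulou1999]
-/

noncomputable section

-- instance search through the nested operator type `E3 →L[ℝ] E3 →L[ℝ] ℝ` (as in the tree files)
set_option maxSynthPendingDepth 3

open Bundle Set Function Filter Manifold Bornology Asymptotics TopologicalSpace
open scoped Manifold ContDiff Topology

namespace Literature.Geometry.Lorentzian

namespace AFEnd

variable {X : Type*} [TopologicalSpace X] [ChartedSpace E3 X]

section Rescale

variable (l : ℝ) (hl : 0 < l)

/-- **Decay of iterated derivatives transports under `x ↦ x/l`**: if
`‖D^m F(x)‖ = o(‖x‖^s)` at infinity then so is `‖D^m (F(·/l))(x)‖` (chain rule for the linear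
change of variables; `‖x/l‖^s = l^{-s} ‖x‖^s`). [folklore] -/
theorem isLittleO_norm_iteratedFDeriv_comp_shrink {l : ℝ} (hl : 0 < l) {V : Type*} [NormedAddCommGroup V]
    [NormedSpace ℝ V] (F : E3 → V) (m : ℕ) (s : ℝ)
    (hF : (fun x ↦ ‖iteratedFDeriv ℝ m F x‖) =o[cobounded E3] fun x ↦ ‖x‖ ^ s) :
    (fun x ↦ ‖iteratedFDeriv ℝ m (fun y ↦ F (l⁻¹ • y)) x‖) =o[cobounded E3] fun x ↦ ‖x‖ ^ s := by
  set L : E3 ≃L[ℝ] E3 := InitialDataSet.shrinkCLE hl.ne' with hL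
  have hcomp : ∀ x, iteratedFDeriv ℝ m (fun y ↦ F (l⁻¹ • y)) x =
      (iteratedFDeriv ℝ m F (L x)).compContinuousLinearMap fun _ ↦ (L : E3 →L[ℝ] E3) := by
    intro x
    have h := L.iteratedFDerivWithin_comp_right F uniqueDiffOn_univ (mem_univ (L x)) m
    rw [preimage_univ, iteratedFDerivWithin_univ, iteratedFDerivWithin_univ] at h
    exact h
  have hbound : ∀ x, ‖iteratedFDeriv ℝ m (fun y ↦ F (l⁻¹ • y)) x‖ ≤
      ‖(L : E3 →L[ℝ] E3)‖ ^ m * ‖iteratedFDeriv ℝ m F (L x)‖ := by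
    intro x
    rw [hcomp]
    refine (ContinuousMultilinearMap.norm_compContinuousLinearMap_le _ _).trans (le_of_eq ?_)
    rw [Finset.prod_const, Finset.card_univ, Fintype.card_fin, mul_comm]
  have h1 : (fun x ↦ ‖iteratedFDeriv ℝ m (fun y ↦ F (l⁻¹ • y)) x‖) =O[cobounded E3]
      fun x ↦ ‖iteratedFDeriv ℝ m F (L x)‖ :=
    IsBigO.of_bound (‖(L : E3 →L[ℝ] E3)‖ ^ m) (Eventually.of_forall fun x ↦ by
      rw [Real.norm_of_nonneg (norm_nonneg _), Real.norm_of_nonneg (norm_nonneg _)]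
      exact hbound x)
  have htend : Tendsto (L : E3 → E3) (cobounded E3) (cobounded E3) :=
    L.antilipschitz.tendsto_cobounded
  have h2 : (fun x ↦ ‖iteratedFDeriv ℝ m F (L x)‖) =o[cobounded E3] fun x ↦ ‖L x‖ ^ s :=
    hF.comp_tendsto htend
  have h3 : (fun x ↦ ‖L x‖ ^ s) =O[cobounded E3] fun x ↦ ‖x‖ ^ s := by
    refine IsBigO.of_bound (l⁻¹ ^ s) (Eventually.of_forall fun x ↦ ?_)
    have hLx : ‖L x‖ = l⁻¹ * ‖x‖ := by
      show ‖l⁻¹ • x‖ = _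
      rw [norm_smul, Real.norm_of_nonneg (inv_nonneg.2 hl.le)]
    rw [hLx, Real.mul_rpow (inv_nonneg.2 hl.le) (norm_nonneg _),
      Real.norm_of_nonneg (by positivity), Real.norm_of_nonneg (by positivity)]
  exact (h1.trans_isLittleO h2).trans_isBigO h3

variable (e : AFEnd X) [IsManifold (𝓡 3) ∞ X] (D : InitialDataSet (𝓡 3) X)

/-- **The Dafermos–Rodnianski rates transport under rescaling, with mass `l M`**:
`h' − (1 + 2lM/r) δ = (h − (1 + 2M/r) δ) ∘ (x ↦ x/l)` and `k' = l⁻¹ k ∘ (x ↦ x/l)`.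
Dafermos–Rodnianski 2013, App. B.2.3. [cite: DafermosRodnianski2013, App. B.2.3] -/
theorem isStronglyAsymptoticallyFlatDR_rescaleEnd {M : ℝ} (h : e.IsStronglyAsymptoticallyFlatDR D M) :
    (e.rescaleEnd l hl).IsStronglyAsymptoticallyFlatDR (D.homothety l hl) (l * M) := by
  obtain ⟨hh, hk⟩ := h
  refine ⟨fun m hm ↦ ?_, fun m hm ↦ ?_⟩
  · set F : E3 → E3 →L[ℝ] E3 →L[ℝ] ℝ :=
      fun z ↦ hCoeff e D z - (1 + 2 * M / ‖z‖) • (innerSL ℝ : E3 →L[ℝ] E3 →L[ℝ] ℝ) with hF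
    have hcoef : ∀ y : E3, 1 + 2 * (l * M) / ‖y‖ = 1 + 2 * M / ‖l⁻¹ • y‖ := fun y ↦ by
      rw [norm_smul, Real.norm_of_nonneg (inv_nonneg.2 hl.le), div_eq_mul_inv, div_eq_mul_inv,
        mul_inv, inv_inv]
      ring
    have hfun : (fun y ↦ hCoeff (e.rescaleEnd l hl) (D.homothety l hl) y -
        (1 + 2 * (l * M) / ‖y‖) • (innerSL ℝ : E3 →L[ℝ] E3 →L[ℝ] ℝ)) = fun y ↦ F (l⁻¹ • y) := by
      funext y
      rw [hF, hCoeff_rescaleEnd, hcoef]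
    rw [hfun]
    exact isLittleO_norm_iteratedFDeriv_comp_shrink hl F m _ (hh m hm)
  · rw [kCoeff_rescaleEnd]
    have hG : ∀ᶠ x in cobounded E3, ContDiffAt ℝ ∞ (fun x ↦ kCoeff e D (l⁻¹ • x)) x := by
      filter_upwards [eventually_cobounded_le_norm (E := E3) (l * e.R + 1)] with x hx
      have hx' : e.R < ‖l⁻¹ • x‖ := by
        rw [norm_smul, Real.norm_of_nonneg (inv_nonneg.2 hl.le), lt_inv_mul_iff₀ hl]; linarith
      have h1 : ContDiffAt ℝ ∞ (kCoeff e D) (l⁻¹ • x) :=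
        (ContDiffOn_kCoeff_holds e D).contDiffAt
          ((isOpen_lt continuous_const continuous_norm).mem_nhds hx')
      exact h1.comp x (l⁻¹ • ContinuousLinearMap.id ℝ E3).contDiff.contDiffAt
    have hev : (fun x ↦ l⁻¹ * ‖iteratedFDeriv ℝ m (fun x ↦ kCoeff e D (l⁻¹ • x)) x‖) =ᶠ[cobounded E3]
        fun x ↦ ‖iteratedFDeriv ℝ m (l⁻¹ • fun x ↦ kCoeff e D (l⁻¹ • x)) x‖ := by
      filter_upwards [hG] with x hx
      rw [iteratedFDeriv_const_smul_apply (hx.of_le (by exact_mod_cast le_top)), norm_smul,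
        Real.norm_of_nonneg (inv_nonneg.2 hl.le)]
    refine IsLittleO.congr' ?_ hev EventuallyEq.rfl
    exact (isLittleO_norm_iteratedFDeriv_comp_shrink hl (kCoeff e D) m _ (hk m hm)).const_mul_left _

end Rescale

end AFEnd

/-! ### Dilation preserves the admissible class -/

namespace InitialDataSet

variable (C : InitialDataSet (𝓡 3) E3) (l : ℝ) (hl : 0 < l)

/-- **Dilation preserves Christodoulou's admissible class**: `C.dilate l` solves the vacuum
constraints, is complete, and its end — the transport of `C`'s end along `y ↦ y/l` with chart
scaled by `l` — is sole and strongly asymptotically flat with mass `l M`. Christodoulou 1999,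
p. A24; Dafermos–Rodnianski 2013, App. B.2.3. [cite: Christodoulou1999, p. A24] -/
theorem dilate_mem_admissibleVacuumData (hC : C ∈ admissibleVacuumData E3) :
    C.dilate l hl ∈ admissibleVacuumData E3 := by
  obtain ⟨hvc, e, M, hsole, hSAF⟩ := hC
  haveI := C.metric.hasLeviCivita
  refine ⟨fun {_} ↦ ⟨C.isVacuumConstraintSolution_dilate l hl hvc.1,
    C.isComplete_dilate l hl hvc.2⟩, ?_⟩
  refine ⟨(e.comap (shrinkCLE hl.ne').toDiffeomorph).rescaleEnd l hl, l * M,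
    AFEnd.isSoleEnd_rescaleEnd l hl _ (e.isSoleEnd_comap _ hsole), ?_⟩
  exact AFEnd.isStronglyAsymptoticallyFlatDR_rescaleEnd l hl _ _
    (e.isStronglyAsymptoticallyFlatDR_comap (shrinkCLE hl.ne').toDiffeomorph C
      (contMDiff_shrinkCLM l) (injective_mfderiv_shrinkCLM hl.ne') hSAF)

include hl in
/-- **Every member `l > 0` of the dilation family is admissible.** [folklore] -/
theorem dilateFamily_mem_admissibleVacuumData (hC : C ∈ admissibleVacuumData E3) :
    C.dilateFamily l ∈ admissibleVacuumData E3 := by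
  rw [dilateFamily_of_pos C hl]
  exact C.dilate_mem_admissibleVacuumData l hl hC

end InitialDataSet

/-! ### Homotheties on an arbitrary `3`-manifold preserve the admissible class

The pointwise homothety `(h, k) ↦ (c² h, c k)` (`InitialDataSet.homothety`, no pull-back) of an admissible datum
on ANY `X` is admissible: the analytic half is `isVacuumConstraintSolution_homothety_iff` /
`isComplete_homothety_iff`, the end half is `AFEnd.isSoleEnd_rescaleEnd` /
`AFEnd.isStronglyAsymptoticallyFlatDR_rescaleEnd` (chart scaled by `c`, mass `c M`). This is the statement
«S1 `AdmissibleDilationClosed`» used by the final-state cells (Christodoulou's admissible class is closed under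
homotheties); the `E3` version with pull-back along `y ↦ y/l` is `dilate_mem_admissibleVacuumData` above. -/

namespace InitialDataSet

/-- **Homothety preserves Christodoulou's admissible class (any `X`)**: for `D ∈ admissibleVacuumData X` and
`c > 0`, `D.homothety c hc ∈ admissibleVacuumData X` — constraints and completeness are homothety-invariant, and
the sole strongly asymptotically flat end survives as `e.rescaleEnd c` with mass `c M`. Christodoulou 1999,
p. A24 (the admissible class); Dafermos–Rodnianski 2013, App. B.2.3 (scaling of the rates).
[cite: Christodoulou1999, p. A24] [cite: DafermosRodnianski2013, App. B.2.3] -/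
theorem homothety_mem_admissibleVacuumData {X : Type*} [TopologicalSpace X] [ChartedSpace E3 X]
    [IsManifold (𝓡 3) ∞ X] (D : InitialDataSet (𝓡 3) X) (c : ℝ) (hc : 0 < c)
    (hD : D ∈ admissibleVacuumData X) : D.homothety c hc ∈ admissibleVacuumData X := by
  obtain ⟨hvc, e, M, hsole, hSAF⟩ := hD
  haveI := D.metric.hasLeviCivita
  exact ⟨fun {_} ↦ ⟨(D.isVacuumConstraintSolution_homothety_iff hc).2 hvc.1,
    (D.isComplete_homothety_iff hc).2 hvc.2⟩, e.rescaleEnd c hc, c * M,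
    AFEnd.isSoleEnd_rescaleEnd c hc e hsole, AFEnd.isStronglyAsymptoticallyFlatDR_rescaleEnd c hc e D hSAF⟩

/-- **«S1 `AdmissibleDilationClosed`» in its universally quantified cell form** (every `3`-manifold `X` with the
standing topological instances, every admissible `D`, every `c > 0`), by `homothety_mem_admissibleVacuumData`.
[cite: Christodoulou1999, p. A24] -/
theorem admissibleVacuumData_homothety_closed :
    ∀ (X : Type) [TopologicalSpace X] [ChartedSpace E3 X] [IsManifold (𝓡 3) ∞ X] [T2Space X]
      [SecondCountableTopology X] [ConnectedSpace X],
      ∀ D ∈ admissibleVacuumData X, ∀ (c : ℝ) (hc : 0 < c), D.homothety c hc ∈ admissibleVacuumData X :=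
  fun _ _ _ _ _ _ _ D hD c hc ↦ D.homothety_mem_admissibleVacuumData c hc hD

end InitialDataSet


end Literature.Geometry.Lorentzian

end
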